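import Mathlib

/-!
# NE7EJWeightMenu — row NE7 (node U5), candidate route HOM, variant H1L-EJ, item EJ-1b′ (T1)–(T3′): the SCALAR MENU OF ADMISSIBLE WEIGHTS behind
# lens 1's flat master inequalities — THEOREM B's `ψ_B = x∕(2+x)` (`g_B = 2∕(2+x)`, `φ_B = x²∕(2+x)`), (hh)'s `ψ_hh = ½x − ⅛x²`, the Padé
# weights `ψ_a = ½a²x∕(a+x)²`, and COROLLARY B1's scalar inequality `ψ_a ≤ ψ_B` on `x ≥ 0` for every `0 < a ≤ 4` (sharp in `a`)

Lineage `b2b-balaban-t4-ne7-p2` (CRUX PROVER NE7 #2 = C-HOM°'s kernel hand), generation 82; file 127.  Mathlib-only imports.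

SOURCE (lens 1 = `t4-ne7-idea-1` gen 73, toy P-EJ-15, `t4/ideate/NE7/lens1-g73/FLATPADE-NOTE.md` d2ccf99438315edd, [NE7IDEA1-G73-INBOX]
L.53663–53672; d = 2, L = 2, one RG step, FLAT abelian model — her words «TOY-MODEL LADDER RUNG … never the NE7 estimate»).  With `EF := Hess_f −
¼Q†Hess_cQ` (the one-step defect form of Bałaban's (42) at the flat background), `K := −Δ_plaq = CCᵀ` (spectrum `[0,8]`) and a scalar profile
`φ(x) = x·ψ(x)`, lens 1 gen 67 (A2) reads «EF^flat ≥ φ(Hess^flat)» as «4AᵀA ≤ g(K)», `g := 1 − ψ`; the weights `g` passing her secular criterion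
(A3) form a CONVEX set (gen 73 (iii)).  Her gen-73 statements: THEOREM B (two lines) «EF^flat ≥ Hess²(2+Hess)⁻¹ = φ₂(Hess)(1+½Hess) ⇔ 4A†A ≤
2(2−Δ_plaq)⁻¹ ⇔ 1 − S = 4AB EXACTLY (h = 1 + 2u) … equality on axis blocks; x²∕(c+x) fails ∀ c < 2; (1+δ)x²∕(2+x) fails ∀ δ > 0»; COROLLARY B1
«EF^flat − φ_a(Hess) ≥ σ_a(Hess), σ_a(x) = x³(a(4−a)+2x)∕(2(2+x)(a+x)²) > 0 on (0,8] iff a ≤ 4 … (MI_a)^flat for a ≤ 4 from B alone»;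
LANDSCAPE «(hh) and B are distinct axis-saturating extreme directions, neither implies the other».
THIS FILE is the scalar (real-variable) half of those statements — the profiles as functions of `x ≥ 0` and the inequalities between them:
* §1 `psiB`, `gB`, `phiB`: `gB = 1 − psiB`, `(2 + x)·gB = 2`, **`inv_gB`** (`g_B⁻¹ = 1 + x∕2` — the secular weight «1 + 2u» at `x = 4u`),
  positivity ∕ range on `x ≥ 0`, `phiB = x·psiB`.
* §2 `psiHH` ((hh)'s `ψ`, `g_hh = 1 − ψ_hh` is file 118's `gFlat`): **`psiHH_sub_psiB`** `= x²(2−x)∕(8(2+x))` — so `ψ_B ≤ ψ_hh` on `[0,2]` and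
  `ψ_hh ≤ ψ_B` on `[2,∞)`: NEITHER DOMINATES (her LANDSCAPE sentence, scalar half).
* §3 `psiA a` (the Padé weight; `x·ψ_a(x) = ½x²∕(1+x∕a)²` = file 121's `phiA a x` for `x ≥ 0`, `mul_psiA`), **`psiB_sub_psiA`** (the closed
  form `x²(a(4−a)+2x)∕(2(2+x)(a+x)²)`), `sigmaA` and `phiB_sub_phiA` (her σ_a), **`psiA_le_psiB`** (COROLLARY B1's scalar inequality:
  `0 < a ≤ 4`, `0 ≤ x`), **`psiB_lt_psiA_of_four_lt`** (for `a > 4` the domination fails at `x = a(a−4)∕4 > 0` — the range `a ≤ 4` is sharp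
  for THIS road; her THEOREM A reaches `a♭ = (3+√41)∕2` by a different certificate, not typed), `psiA_le` (`ψ_a ≤ a∕8`, so `g_a ≥ ½` for `a ≤ 4`).
* §4 the affine family `gC c = c∕(c+x)` (`g_C⁻¹ = 1 + x∕c`; `gC 2 = gB`) behind «c = 2 is extremal» (the secular side is file 128).
The secular identity `S_B = 1 − 4AB` is file 128 (`NE7EJFlatSecularB`); the torus-level statements are files 129–131.

HONEST FRAMING: [folklore] one-variable real algebra; the OBJECTS and their meaning are lens 1's (d = 2 flat toy); nothing of Bałaban's is
instantiated; no d = 4 statement, no curved background, nothing at ε > 0; NOT a letter move (PRICING-NE7 v56 §413: toy rungs at zero letter);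
T-50-10 honoured.  NE7 NOT PRINTED ∕ NOT PROVED; spine 0∕9; FIXED FINITE T⁴, rung (B)+1; NOT infinite volume, NOT mass gap, NOT Clay.  HONEST
DEPENDENCY: continuum YM on T⁴ ⇐ BetaPertH ∧ nine spine estimates (0/9 proved); BetaPertH ⇐ (D1) ∧ (D4) ∧ CAP+tail; G-an2-4 gates asym, D1
and NE2/3/4.
-/

noncomputable section

namespace Summit.QuantumFields.BalabanUV.T4Continuum.NE7EJWeightMenu

/-! ### §1 THEOREM B's profile: `ψ_B = x∕(2+x)`, `g_B = 2∕(2+x)`, `φ_B = x²∕(2+x)` -/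

/-- `ψ_B(x) := x∕(2+x)` — the multiplier of THEOREM B's right-hand side `Hess²(2+Hess)⁻¹ = Cᵀψ_B(K)C`. [folklore] -/
def psiB (x : ℝ) : ℝ := x / (2 + x)

/-- `g_B(x) := 2∕(2+x) = 1 − ψ_B(x)` — THEOREM B's weight in «4AᵀA ≤ g_B(K) = 2(2+K)⁻¹». [folklore] -/
def gB (x : ℝ) : ℝ := 2 / (2 + x)

/-- `φ_B(x) := x²∕(2+x) = x·ψ_B(x)` — THEOREM B's profile `φ_B(Hess) = Hess²(2+Hess)⁻¹`. [folklore] -/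
def phiB (x : ℝ) : ℝ := x ^ 2 / (2 + x)

/-- `φ_B = x·ψ_B`. [folklore] -/
theorem phiB_eq_mul_psiB (x : ℝ) : phiB x = x * psiB x := by unfold phiB psiB; ring

/-- `g_B = 1 − ψ_B` (off the pole). [folklore] -/
theorem gB_eq_one_sub_psiB {x : ℝ} (h : 2 + x ≠ 0) : gB x = 1 - psiB x := by
  unfold gB psiB; field_simp; ring

/-- `(2 + x)·g_B(x) = 2`: `g_B(K)` is twice the RESOLVENT `(2 + K)⁻¹`. [folklore] -/
theorem two_add_mul_gB {x : ℝ} (h : 2 + x ≠ 0) : (2 + x) * gB x = 2 := by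
  unfold gB; field_simp

/-- **`g_B⁻¹ = 1 + x∕2`** — at `x = ω = 4u` this is lens 1's secular weight «h = 1 + 2u». [folklore] -/
theorem inv_gB {x : ℝ} (h : 2 + x ≠ 0) : (gB x)⁻¹ = 1 + x / 2 := by
  unfold gB; rw [inv_div]; field_simp

/-- the same at `x = 4u`: `g_B(4u)⁻¹ = 1 + 2u` (`u ≥ 0`). [folklore] -/
theorem inv_gB_four_mul {u : ℝ} (hu : 0 ≤ u) : (gB (4 * u))⁻¹ = 1 + 2 * u := by
  rw [inv_gB (by linarith)]; ring

/-- `g_B > 0` to the right of the pole. [folklore] -/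
theorem gB_pos {x : ℝ} (hx : -2 < x) : 0 < gB x := by
  unfold gB; exact div_pos two_pos (by linarith)

/-- `g_B ≤ 1` on `x ≥ 0`. [folklore] -/
theorem gB_le_one {x : ℝ} (hx : 0 ≤ x) : gB x ≤ 1 := by
  unfold gB; rw [div_le_one (by linarith)]; linarith

/-- `0 ≤ ψ_B` on `x ≥ 0`. [folklore] -/
theorem psiB_nonneg {x : ℝ} (hx : 0 ≤ x) : 0 ≤ psiB x := by
  unfold psiB; positivity

/-- `ψ_B < 1` on `x ≥ 0`. [folklore] -/
theorem psiB_lt_one {x : ℝ} (hx : 0 ≤ x) : psiB x < 1 := by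
  unfold psiB; rw [div_lt_one (by linarith)]; linarith

/-- `ψ_B` is non-decreasing on `x ≥ 0`. [folklore] -/
theorem psiB_mono {x y : ℝ} (hx : 0 ≤ x) (hxy : x ≤ y) : psiB x ≤ psiB y := by
  unfold psiB
  rw [div_le_div_iff₀ (by linarith) (by linarith)]
  nlinarith

/-- `0 ≤ φ_B` on `x ≥ 0`. [folklore] -/
theorem phiB_nonneg {x : ℝ} (hx : 0 ≤ x) : 0 ≤ phiB x := by
  unfold phiB; positivity

/-- `φ_B(x) = φ₂(x)·(1 + ½x)` with `φ₂(x) = ½x²∕(1+x∕2)² = 2x²∕(2+x)²` (lens 1's «= φ₂(Hess)(1+½Hess)»). [folklore] -/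
theorem phiB_eq_phi2_mul {x : ℝ} (h : 2 + x ≠ 0) : phiB x = (2 * x ^ 2 / (2 + x) ^ 2) * (1 + x / 2) := by
  unfold phiB; field_simp

/-! ### §2 (hh)'s profile for comparison: `ψ_hh = ½x − ⅛x²` — neither dominates -/

/-- `ψ_hh(x) := ½x − ⅛x²` (so `φ_hh = x·ψ_hh = ⅛x²(4−x)` and `g_hh = 1 − ψ_hh = 1 − ½x + ⅛x²`, file 118's `gFlat`). [folklore] -/
def psiHH (x : ℝ) : ℝ := (1 / 2) * x - (1 / 8) * x ^ 2

/-- `x·ψ_hh(x) = ⅛x²(4 − x)` (lens 1's THEOREM (hh) profile). [folklore] -/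
theorem mul_psiHH (x : ℝ) : x * psiHH x = (1 / 8) * x ^ 2 * (4 - x) := by unfold psiHH; ring

/-- **`ψ_hh − ψ_B = x²(2 − x)∕(8(2 + x))`**. [folklore] -/
theorem psiHH_sub_psiB {x : ℝ} (h : 2 + x ≠ 0) : psiHH x - psiB x = x ^ 2 * (2 - x) / (8 * (2 + x)) := by
  unfold psiHH psiB; field_simp; ring

/-- on `[0,2]`: `ψ_B ≤ ψ_hh` ((hh) is the stronger profile at low energies). [folklore] -/
theorem psiB_le_psiHH {x : ℝ} (hx : 0 ≤ x) (hx2 : x ≤ 2) : psiB x ≤ psiHH x := by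
  have h : 2 + x ≠ 0 := by linarith
  have := psiHH_sub_psiB h
  have hnn : 0 ≤ x ^ 2 * (2 - x) / (8 * (2 + x)) := div_nonneg (mul_nonneg (sq_nonneg _) (by linarith)) (by linarith)
  linarith

/-- on `[2,∞)`: `ψ_hh ≤ ψ_B` (THEOREM B is the stronger profile at high energies) — «neither implies the other»; they agree at `x ∈ {0, 2}`.
[folklore] -/
theorem psiHH_le_psiB {x : ℝ} (hx2 : 2 ≤ x) : psiHH x ≤ psiB x := by
  have h : 2 + x ≠ 0 := by linarith
  have := psiHH_sub_psiB h
  have hnp : x ^ 2 * (2 - x) / (8 * (2 + x)) ≤ 0 :=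
    div_nonpos_of_nonpos_of_nonneg (mul_nonpos_of_nonneg_of_nonpos (sq_nonneg _) (by linarith)) (by linarith)
  linarith

/-- the two profiles agree exactly at `x = 0` and `x = 2`. [folklore] -/
theorem psiHH_eq_psiB_iff {x : ℝ} (hx : 0 ≤ x) : psiHH x = psiB x ↔ x = 0 ∨ x = 2 := by
  have h : 2 + x ≠ 0 := by linarith
  rw [← sub_eq_zero, psiHH_sub_psiB h, div_eq_zero_iff, mul_eq_zero]
  constructor
  · rintro ((h0 | h2) | h8)
    · exact Or.inl (pow_eq_zero_iff two_ne_zero |>.mp h0)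
    · exact Or.inr (by linarith)
    · exact absurd h8 (by linarith)
  · rintro (h0 | h2)
    · exact Or.inl (Or.inl (by rw [h0]; ring))
    · exact Or.inl (Or.inr (by rw [h2]; ring))

/-! ### §3 The Padé weights `ψ_a = ½a²x∕(a+x)²` and COROLLARY B1's scalar inequality -/

/-- `ψ_a(x) := ½a²x∕(a+x)²` — so that `x·ψ_a(x) = ½x²∕(1+x∕a)² = φ_a(x)`, lens 1's Padé profile (file 121's `phiA a x` at `|x| = x`). [folklore] -/
def psiA (a x : ℝ) : ℝ := (1 / 2) * a ^ 2 * x / (a + x) ^ 2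

/-- `x·ψ_a(x) = ½x²∕(1 + x∕a)²` for `a > 0`, `x ≥ 0` (= `NE7EJDefectSpectral.phiA a x` there, since `|x| = x`). [folklore] -/
theorem mul_psiA {a x : ℝ} (ha : 0 < a) (hx : 0 ≤ x) : x * psiA a x = (1 / 2) * x ^ 2 / (1 + x / a) ^ 2 := by
  unfold psiA
  have h1 : a + x ≠ 0 := by linarith
  have h2 : 1 + x / a ≠ 0 := by positivity
  field_simp

/-- `0 ≤ ψ_a` on `x ≥ 0`. [folklore] -/
theorem psiA_nonneg (a : ℝ) {x : ℝ} (hx : 0 ≤ x) : 0 ≤ psiA a x := by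
  unfold psiA; positivity

/-- `ψ_a ≤ a∕8` for `a > 0`, `x ≥ 0` (AM–GM: `4ax ≤ (a+x)²`); hence `g_a = 1 − ψ_a ≥ ½` whenever `a ≤ 4`. [folklore] -/
theorem psiA_le {a x : ℝ} (ha : 0 < a) (hx : 0 ≤ x) : psiA a x ≤ a / 8 := by
  unfold psiA
  rw [div_le_div_iff₀ (by positivity) (by norm_num)]
  nlinarith [sq_nonneg (a - x), ha.le, hx]

/-- **`ψ_B − ψ_a = x²(a(4−a) + 2x)∕(2(2+x)(a+x)²)`** (off the poles). [folklore] -/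
theorem psiB_sub_psiA {a x : ℝ} (h2 : 2 + x ≠ 0) (ha : a + x ≠ 0) :
    psiB x - psiA a x = x ^ 2 * (a * (4 - a) + 2 * x) / (2 * (2 + x) * (a + x) ^ 2) := by
  unfold psiB psiA
  field_simp
  ring

/-- lens 1's `σ_a(x) := x³(a(4−a)+2x)∕(2(2+x)(a+x)²)`. [folklore] -/
def sigmaA (a x : ℝ) : ℝ := x ^ 3 * (a * (4 - a) + 2 * x) / (2 * (2 + x) * (a + x) ^ 2)

/-- **`φ_B − φ_a = σ_a`**: `x·ψ_B(x) − x·ψ_a(x) = σ_a(x)` (off the poles) — COROLLARY B1's identity. [folklore] -/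
theorem phiB_sub_phiA {a x : ℝ} (h2 : 2 + x ≠ 0) (ha : a + x ≠ 0) : x * psiB x - x * psiA a x = sigmaA a x := by
  rw [← mul_sub, psiB_sub_psiA h2 ha]; unfold sigmaA; field_simp

/-- `σ_a ≥ 0` on `x ≥ 0` for `0 < a ≤ 4`. [folklore] -/
theorem sigmaA_nonneg {a x : ℝ} (ha : 0 < a) (ha4 : a ≤ 4) (hx : 0 ≤ x) : 0 ≤ sigmaA a x := by
  unfold sigmaA
  exact div_nonneg (mul_nonneg (pow_nonneg hx 3) (by nlinarith)) (by positivity)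

/-- **COROLLARY B1, scalar half**: for `0 < a ≤ 4` and `x ≥ 0`, `ψ_a(x) ≤ ψ_B(x)` (so `φ_a ≤ φ_B` and, by THEOREM B, «(MI_a)^flat for a ≤ 4
from B alone»). [folklore] -/
theorem psiA_le_psiB {a x : ℝ} (ha : 0 < a) (ha4 : a ≤ 4) (hx : 0 ≤ x) : psiA a x ≤ psiB x := by
  have h := psiB_sub_psiA (a := a) (x := x) (by linarith) (by linarith)
  have hnn : 0 ≤ x ^ 2 * (a * (4 - a) + 2 * x) / (2 * (2 + x) * (a + x) ^ 2) :=
    div_nonneg (mul_nonneg (sq_nonneg _) (by nlinarith)) (by positivity)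
  linarith

/-- the same for the profiles: `x·ψ_a(x) ≤ x·ψ_B(x)`, i.e. `φ_a ≤ φ_B` on `x ≥ 0`, `0 < a ≤ 4`. [folklore] -/
theorem mul_psiA_le_mul_psiB {a x : ℝ} (ha : 0 < a) (ha4 : a ≤ 4) (hx : 0 ≤ x) : x * psiA a x ≤ x * psiB x :=
  mul_le_mul_of_nonneg_left (psiA_le_psiB ha ha4 hx) hx

/-- **the range `a ≤ 4` is sharp for domination by `ψ_B`**: if `a > 4` then at `x₀ = a(a−4)∕4 > 0`, `ψ_B(x₀) < ψ_a(x₀)` (there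
`a(4−a) + 2x₀ = −a(a−4)∕2 < 0`). [folklore] -/
theorem psiB_lt_psiA_of_four_lt {a : ℝ} (ha : 4 < a) : psiB (a * (a - 4) / 4) < psiA a (a * (a - 4) / 4) := by
  set x := a * (a - 4) / 4 with hx
  have hxpos : 0 < x := by rw [hx]; exact div_pos (mul_pos (by linarith) (by linarith)) (by norm_num)
  have h := psiB_sub_psiA (a := a) (x := x) (by linarith) (by linarith)
  have hneg : x ^ 2 * (a * (4 - a) + 2 * x) / (2 * (2 + x) * (a + x) ^ 2) < 0 := by
    apply div_neg_of_neg_of_pos _ (by positivity)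
    apply mul_neg_of_pos_of_neg (pow_pos hxpos 2)
    rw [hx]; nlinarith
  linarith

/-- `ψ_a` is non-decreasing in `a` on `x ≥ 0` (lens 1: «S_a ↑ in a»). [folklore] -/
theorem psiA_mono_a {a b x : ℝ} (ha : 0 < a) (hab : a ≤ b) (hx : 0 ≤ x) : psiA a x ≤ psiA b x := by
  have hb : 0 < b := lt_of_lt_of_le ha hab
  unfold psiA
  rw [div_le_div_iff₀ (by positivity) (by positivity)]
  -- ½a²x(b+x)² ≤ ½b²x(a+x)²  ⇐  a(b+x) ≤ b(a+x)  ⇐  ax ≤ bx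
  have h1 : a * (b + x) ≤ b * (a + x) := by nlinarith
  have h2 : 0 ≤ a * (b + x) := by positivity
  have h3 : (a * (b + x)) ^ 2 ≤ (b * (a + x)) ^ 2 := pow_le_pow_left₀ h2 h1 2
  nlinarith [h3, hx]

/-! ### §4 The affine family `g_c = c∕(c+x)` («c = 2 is extremal»; the secular side is file 128) -/

/-- `g_c(x) := c∕(c+x)`, the weight of the profile `x²∕(c+x)`. [folklore] -/
def gC (c x : ℝ) : ℝ := c / (c + x)

/-- `g_2 = g_B`. [folklore] -/
theorem gC_two : gC 2 = gB := by
  funext x; rfl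

/-- **`g_c⁻¹ = 1 + x∕c`** — the secular weight of the profile `x²∕(c+x)` (`= 1 + 4u∕c` at `x = 4u`). [folklore] -/
theorem inv_gC {c x : ℝ} (hc : c ≠ 0) (h : c + x ≠ 0) : (gC c x)⁻¹ = 1 + x / c := by
  unfold gC; rw [inv_div]; field_simp

/-- `g_c > 0` for `c > 0`, `x ≥ 0`. [folklore] -/
theorem gC_pos {c x : ℝ} (hc : 0 < c) (hx : 0 ≤ x) : 0 < gC c x := by
  unfold gC; positivity

end Summit.QuantumFields.BalabanUV.T4Continuum.NE7EJWeightMenu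

end
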